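import Summits.NavierStokesRegularity.NavierStokesRegularity.Theses.SymmetryModuliCount
import Literature.Analysis.FluidPDE.TypeIAncientMild
import Literature.Analysis.FluidPDE.KatoSymmetryCovariance
import Literature.Analysis.FluidPDE.KNSSOseenMildDecayTools
-- landed Negative lemmas of this crux (`symmetricLiouville_false_without_typeI/_without_mild/_with_bounded`,
-- `_typeI_near_zero_bounded_past`, `_mild_on_window`, `_on_window`), imported so the scratch check sees them:
-- every stub below keeps the FULL class `IsTypeIAncientMild C u` (Type-I decay back to −∞ AND the Oseen
-- identity back to −∞), so none is an instance of a refuted mutant.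
import Summits.NavierStokesRegularity.NavierStokesRegularity.Theorems.SymmetricLiouville.Negative.LoadBearing
import HarnessLib.Audit

/-!
# Skeleton line `degenerate-stabiliser-zoom` for crux `SymmetricLiouville` (stmt-NavierStokesRegularity-4053)

Route `SymmetryModuliCount`, sub-problem `NavierStokesRegularity` (Clay A, positive side). Crux-plan skeleton
(planner `cruxplan-stmt-NavierStokesRegularity-4053-degenerate-stabiliser-zoom`, round 1) of the idea card
`Cruxes/SymmetricLiouville/Ideas/degenerate-stabiliser-zoom.md` (ideator 1), with the panel notes
`TRIAGE-r1-{1,2,3}.md` (pass ×3; sharpenings acted on: L1.6 restated via the global Oseen bootstrap instead of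
local vorticity ε-regularity, whose integral `∫_{−δ}^t (t−τ)^{-1/2}(−τ)^{-1/2}dτ` is log-divergent; the helical
half and the axis half are the panel's two merge groups, here one stub each).

## The crux and its conjugacy classes

`SymmetricLiouville`: every `u` in the Type-I KNSS-mild ancient class `A_C` (`IsTypeIAncientMild C u`,
definitionally the four clauses of the decl, `isTypeIAncientMild_iff`) annihilated by the generator
`L_ξ u = ∇u·(a + σx + Ax) + σu + 2σt ∂_t u − Au` of a nonzero `ξ = (a, σ, A) ∈ sim(3)` (`A` skew) vanishes.
THE LEVER of the card: conjugating the stabiliser of `u` by parabolic zooms centred OFF its fixed locus degenerates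
it to a TRANSLATION (blow-down kills the pitch of a screw; recentring at parabolic infinity kills rotation and
scaling), the zoomed family is precompact in `A_C` with the SAME `C`, and a translation-invariant element of
`A_C` is `0` (PROVED tree theorem `KNSS2009_typeI_rate_liouville_holds`). Up to conjugation by translations
(proved here, `isTypeIAncientMild_comp_add_right`) and the normalisation `ξ ↦ ξ/σ` the leaves are:

* `σ = 0`, `a ∉ range A` — translations and screws of NONZERO pitch: `stub_helicalEndLiouville` (card §(H),
  L1.1–L1.4: screw ⊃ lattice ⇒ periodic ⇒ blow-down shrinks the period ⇒ translation leaf ⇒ `√(−t)‖u‖∞ → 0`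
  at `−∞` ⇒ Kato gap). VERBATIM the route item `HelicalEndLiouville` (stmt-14062, crux r7 of the route, added
  at rev 8 from this crux chain): restated as a stub only because the farm snapshot serving this check predates
  rev 8 (the item decl is not yet importable); any proof of the item is a proof of this stub, and conversely.
* `σ = 0`, `a = A c`, `A ≠ 0` — rotations about the axis `−c + ker A`, swirl allowed: `stub_axisymEndLiouville`
  (card L1.7 recentring + Oseen bootstrap along the axis + KNSS Thm 5.3 = tree
  `KNSS2009_liouville_bound_C_over_r_holds`, or the route's plan in Albritton–Barker's class). VERBATIM the
  route item `AxisymEndLiouville` (stmt-14061, crux r4), same remark.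
* `σ ≠ 0` — spiral scalings about the centre `c`, `(σ + A)c = −a` (`exists_spiral_centre`): after translating
  and dividing by `σ` the symmetry reads `∇u·(x + A′x) + u + 2t∂_t u − A′u = 0`, `A′ = A/σ` — `u` is backward
  (rotated) self-similar about the space–time origin with a BOUNDED smooth profile. Cut exactly as the card's
  `Transfer:` C⁺ and the triage sharpenings prescribe:
  1. `stub_spiralFarFieldVanishing` (card L1.5 = Lemma A / B1 of the merge group; M): THE DEGENERATE-STABILISER
     ZOOM — recentring at points with `|x|/√(−t) → ∞` conjugates the generator to `(a_n, 1, A′)` with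
     `|a_n|² = |x_n|² + |A′x_n|² → ∞`; dividing by `|a_n|` and passing to a `C¹_loc`-limit in `A_C` leaves a
     nonzero TRANSLATION-invariant element — impossible. Output: the bounded profile DECAYS at infinity.
  2. `stub_oseenBootstrap` (card L1.6 as sharpened; Lemma B / B2; L): SYMMETRY-FREE — an element of `A_C` which
     is `o(1/√(−t))` outside parabolas is `O(1/(|x| + √(−t)))` (ancient Oseen identity from `s = −∞`, master
     inequality `m(L) ≤ K₁m(L/4)² + (K₂/L)∫₀ᴸm² + K₃C²/L`, no logarithm — re-derived region by region by two
     triagers), i.e. `HasTypeIDecay K u` = Pineau–Vicol (1.10).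
  3. `stub_selfSimilarLeaf` (leaf (D₀); M, KNOWN): `A′ = 0` — Tsai 1998 Thm 1, `q = ∞` = tree theorem
     `tsai_selfsimilar_bounded_holds` makes the profile constant, and the gauge kills constant slices
     (`IsTypeIAncientMild.eq_zero_of_slice_const`).
  4. `stub_rotatedSelfSimilarDecayingLiouville` (the residual; X-strength on its leaf; HARDEST): `A′ ≠ 0` in the
     class of stub 2 — literally the disprover's residual open core `Disproof.RotatedSelfSimilarLiouvilleDecaying`
     = Pineau–Vicol 2026 Conj. 1.1 = Tsai 2018 Conj. 8.9: PROVED for `|α| < α₁(K)` and `|α| > α₂(K)` (PV Thm 1.4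
     = tree named fact `pineauVicol2026_rss_liouville`, whose hypothesis (1.10) is `HasTypeIDecay`), OPEN on the
     window `α₁ ≤ |α| ≤ α₂`. The crux implies this stub (`Disproof.symmetricLiouville_implies_rss_decaying`), so
     nothing weaker can stand in its place; what stubs 1–2 buy is that the crux's BOUNDED-profile row now lives
     in Pineau–Vicol's decaying class, where PV Lemma 2.1 / Prop. 3.1 / Prop. 5.1, CKN and Tsai Thm 2 apply.

`SymmetricLiouville_of` is the composition, sorry-free, concluding the crux decl BY NAME; the conjugations
(translation to the centre / to the axis, `ξ ↦ ξ/σ`, the split `a ∈ range A`) are carried out in its proof.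
For the ROUTE only stubs H/Ax matter (time-anchor collapse, rev 5 `closes`); stubs 3–4 are this crux's own rows.

## Disproof used (`Cruxes/SymmetricLiouville/Disproof.lean` v6 + landed `Theorems/SymmetricLiouville/Negative/*`)

Every stub quantifies over the full class `IsTypeIAncientMild C u` on a backward END (all of `t < θ`, `θ ≤ 0`):
`_false_without_typeI` / `_false_typeI_near_zero_bounded_past` — the decay AT `−∞` is used in stub H (blow-down
limits and the Kato gap at `−∞`), stub 1 (recentred limits are killed by the Type-I translation leaf; constants
are excluded only by the decay) and stub 2 (free term `e^{(t−s)Δ}u(s) → 0` as `s → −∞`); `_false_without_mild` /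
`_false_mild_on_window` — the Oseen identity back to `−∞` is used in stub 2 (ancient Duhamel representation),
stub H (Kato gap) and stub 3 (the parasitic `c/√(−t)` solves the scaling symmetry and is Type-I; only the gauge
kills it: `eq_zero_of_slice_const`); `_false_on_window` (shear wave) — stubs H, 1, 2 are void on finite windows
by design (zoom-outs leave every window); `_false_with_bounded` — no stub concludes `u = 0` from boundedness.
Negatives index (stmt-4055 `FiniteTangentModuli`, stmt-0154): untouched — no stub is a linearised/tangent count.
-/

noncomputable section

set_option linter.dupNamespace false

open Set Function
open scoped InnerProductSpace RealInnerProductSpace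
open Literature.Analysis.FluidPDE
open Summit.NavierStokesRegularity.NavierStokesRegularity.Theses.SymmetryModuliCount

namespace Summit.NavierStokesRegularity.NavierStokesRegularity.Cruxes.SymmetricLiouville.DegenerateStabiliserZoom

/-! ## The Killing leaves `σ = 0` (two stubs = the route items `HelicalEndLiouville`, `AxisymEndLiouville`) -/

/-- **Stub H — helical / translational (= periodic) leaf on a backward end** (card §(H), L1.1–L1.4; size M–L;
VERBATIM the route item `HelicalEndLiouville`, stmt-NavierStokesRegularity-14062).  If `u ∈ A_C` is annihilated
on `t < θ` (`θ ≤ 0`) by a Killing generator `(a + Ax)·∇ − A`, `A` skew, `a ∉ range A` — a translation (`A = 0`,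
`a ≠ 0`) or a screw of NONZERO pitch — then `u ≡ 0` on `t < θ`.  Proof plan (the card's lever, checked by all
three triagers): (i) screw ⊃ lattice — skew `A ≠ 0` on `ℝ³` has spectrum `{0, ±iρ}`, `e^{(2π/ρ)A} = I`, and the
screw flow over one turn is the translation by `p = (2π/ρ)·P_{ker A} a ≠ 0` (`p = a` if `A = 0`), so
`u(t, x + p) = u(t, x)`; (ii) BLOW-DOWN KILLS THE PERIOD — if `M := limsup_{t→−∞} √(−t)‖u(t)‖∞ > 0`, zoom OUT at
near-maximisers, `v_n(s,y) = λ_n u(λ_n² s, x_n + λ_n y)`, `λ_n = √(−t_n) → ∞`: `v_n ∈ A_C` (same `C`;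
`isTypeIAncientMild_comp_add_right` + parabolic rescaling `oseenDuhamel_parabolicRescale`), period `p/λ_n → 0`,
`|v_n(−1,0)| ≥ M/2`; KNSS-type compactness + mild closure of `A_C` (uniform Prop. 4.1 bounds on `s ≤ −δ`,
Arzelà–Ascoli, dominated convergence in the Oseen term via `exists_norm_oseenKernel_le`) gives a limit `w ∈ A_C`,
nonzero at `(−1,0)` and invariant under ALL translations along `p`: contradiction with the PROVED tree theorem
`KNSS2009_typeI_rate_liouville_holds` (applied to the bounded shift `w(·−δ)`, `IsTypeIAncientMild.comp_sub_right`,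
after rotating `p` onto `e₁`); (iii) so `√(−t)‖u(t)‖∞ → 0` as `t → −∞`, and the Kato gap from the ancient Oseen
identity, `√(−t)‖u(t)‖∞ ≤ cπ (sup_{τ≤t} √(−τ)‖u(τ)‖∞)²` (`∫_{−∞}^t (t−τ)^{-1/2}(−τ)^{-1}dτ = π/√(−t)`), forces
`u ≡ 0` on some `(−∞, T]`; forward uniqueness (`oseenMild_bounded_unique`) finishes on `(T, θ)`. -/
theorem stub_helicalEndLiouville :
    ∀ (C : ℝ) (u : ℝ → EuclideanSpace ℝ (Fin 3) → EuclideanSpace ℝ (Fin 3)),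
      IsTypeIAncientMild C u →
      ∀ (a : EuclideanSpace ℝ (Fin 3)) (A : EuclideanSpace ℝ (Fin 3) →L[ℝ] EuclideanSpace ℝ (Fin 3)) (θ : ℝ),
        (∀ x, inner ℝ (A x) x = 0) → a ∉ Set.range A → θ ≤ 0 →
        (∀ t < θ, ∀ x, fderiv ℝ (u t) x (a + A x) - A (u t x) = 0) →
        ∀ t < θ, ∀ x, u t x = 0 := by
  sorry

/-- **Stub Ax — axisymmetric leaf on a backward end, swirl allowed, any axis** (card L1.7 + the axis endgame;
size L; VERBATIM the route item `AxisymEndLiouville`, stmt-NavierStokesRegularity-14061).  If `u ∈ A_C` is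
annihilated on `t < θ` (`θ ≤ 0`) by the rotations about the axis through `c` generated by a nonzero skew `A`
(`∇u·A(x − c) − Au = 0`) then `u ≡ 0` on `t < θ`.  Proof plans on record: (a) the card's — recentring at points
with `dist(x, axis)/√(−t) → ∞` degenerates the rotation to a translation, so `√(−t)‖u‖ → 0` there (as in stub 1),
the axis version of the Oseen bootstrap (stub 2, cylindrical geometry, no logarithm: TRIAGE-r1-2 §C, r1-3) gives
`dist(x, axis)·‖u‖ ≤ K`, and KNSS 2009 Thm 5.3 = PROVED tree theorem `KNSS2009_liouville_bound_C_over_r_holds`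
applied to the bounded shifts `u(·−δ)` concludes (swirl bound alternative: card `swirl-barrier-past`,
`|r u_θ| ≤ 2C²`); (b) the route's — in Albritton–Barker's class `{𝐈 < ∞} ⊇ A_C` (item `FarPastLedger`), blow
down at a nonzero point, persistence of singularities, Seregin–Šverák 2009 Thm 3.1 = tree
`AxisymmetricTypeIExclusion_holds`. -/
theorem stub_axisymEndLiouville :
    ∀ (C : ℝ) (u : ℝ → EuclideanSpace ℝ (Fin 3) → EuclideanSpace ℝ (Fin 3)),
      IsTypeIAncientMild C u →
      ∀ (c : EuclideanSpace ℝ (Fin 3)) (A : EuclideanSpace ℝ (Fin 3) →L[ℝ] EuclideanSpace ℝ (Fin 3)) (θ : ℝ),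
        (∀ x, inner ℝ (A x) x = 0) → A ≠ 0 → θ ≤ 0 →
        (∀ t < θ, ∀ x, fderiv ℝ (u t) x (A (x - c)) - A (u t x) = 0) →
        ∀ t < θ, ∀ x, u t x = 0 := by
  sorry

/-! ## The spiral-scaling leaf `σ ≠ 0` (four stubs; normalised to centre `0` and rate `σ = 1`) -/

/-- **Stub 1 — the degenerate-stabiliser zoom: the profile of a spiral-scaling-symmetric element of `A_C`
decays at parabolic infinity** (card L1.5; Lemma A / B1 of cards `stabiliser-at-infinity-decay` /
`farfield-recentring-critical-rate`; size M).  If `u ∈ A_C` is annihilated by the spiral-scaling generator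
about the space–time origin, `∇u·(x + Ax) + u + 2t ∂_t u − Au = 0` (`A` skew, possibly `0`), then
`√(−t)‖u(t,x)‖ → 0` as `‖x‖/√(−t) → ∞`, uniformly: for every `ε > 0` there is `R` with
`√(−t)‖u(t,x)‖ ≤ ε` whenever `‖x‖ ≥ R√(−t)`.  Proof plan: if not, pick violating points, rescale each to time
`−1` (class and symmetry are invariant under `u ↦ λu(λ²t, λx)`, which commutes with the spiral group), translate
the point to the origin (`isTypeIAncientMild_comp_add_right`; the generator becomes `(x_n + Ax_n, 1, A)` with
`|x_n + Ax_n|² = |x_n|² + |Ax_n|² → ∞` by skewness), divide the identity by `|x_n + Ax_n|` and pass to a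
`C¹_loc`-limit in `A_C` (KNSS Prop. 4.1-type uniform bounds on `t ≤ −δ` + Arzelà–Ascoli + dominated convergence
in the Oseen identity, `exists_norm_oseenKernel_le` — the compactness input shared with stub H and with support
item `LiouvilleKillsTypeI`): the limit is a NONZERO element of `A_C` annihilated by a pure translation `â·∇`
(the `σ`-, `A`- and `2t∂_t`-terms carry the factor `1/|a_n| → 0` against locally bounded `v_n, ∇v_n, ∂_t v_n`),
contradicting the translation leaf (stub H with `A = 0`, i.e. `KNSS2009_typeI_rate_liouville_holds`). -/
theorem stub_spiralFarFieldVanishing :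
    ∀ (C : ℝ) (u : ℝ → EuclideanSpace ℝ (Fin 3) → EuclideanSpace ℝ (Fin 3))
      (A : EuclideanSpace ℝ (Fin 3) →L[ℝ] EuclideanSpace ℝ (Fin 3)),
      IsTypeIAncientMild C u →
      (∀ x, inner ℝ (A x) x = 0) →
      (∀ t < 0, ∀ x, fderiv ℝ (u t) x (x + A x) + u t x + (2 * t) • timeDeriv u t x - A (u t x) = 0) →
      ∀ ε > 0, ∃ R : ℝ, ∀ t < 0, ∀ x, R * Real.sqrt (-t) ≤ ‖x‖ → Real.sqrt (-t) * ‖u t x‖ ≤ ε := by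
  sorry

/-- **Stub 2 — the Oseen bootstrap `o(1) ⇒ K/|x|` (symmetry-free)** (card L1.6 as sharpened by triage
r1-1/r1-2; Lemma B / B2 of the merge group; size L).  An element of `A_C` which is `o(1/√(−t))` outside the
parabolas `‖x‖ ≥ R√(−t)` obeys the SPACE–TIME Type-I bound `‖u(t,x)‖ ≤ K/(‖x‖ + √(−t))` (`HasTypeIDecay K u`,
= Pineau–Vicol (1.10) ⇔ (1.9), = the hypothesis class of `pineauVicol2026_rss_liouville` and of Tsai's `L^q`,
`q > 3`).  Proof plan: let `s → −∞` in the Oseen identity (free term `≤ C/√(−s) → 0` by the Type-I decay; the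
Duhamel term converges absolutely, `exists_lintegral_enorm_oseenKernel_le`), so
`u(t,x) = −∫_{−∞}^t ∫ K(t−τ, x−y)[u⊗u](τ,y) dy dτ`; with `m(L) := sup {√(−t)‖u(t,x)‖ : ‖x‖ ≥ L√(−t)}` split the
`(τ, y)`-integral into the far region `‖y‖ ≥ (L/4)√(−τ)` (`≤ K₁ m(L/4)²`, using
`∫_{−∞}^t (t−τ)^{-1/2}(−τ)^{-1} dτ = π/√(−t)`), the recent core and the old core (kernel decay
`|K(τ,z)| ≤ C₀(τ + |z|²)^{-2}` = `exists_norm_oseenKernel_le`, core mass `C²(−τ)^{1/2}`): master inequality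
`m(L) ≤ K₁ m(L/4)² + (K₂/L)∫₀ᴸ m(ℓ)² dℓ + K₃ C²/L` with NO logarithm (TRIAGE-r1-1 S6 / r1-2 §C / r1-3); since
`m(L) → 0` (hypothesis) the quadratic term is absorbed and two stages (power rate, then exponent doubling) give
`m(L) ≤ K/L`; with `‖u‖ ≤ C/√(−t)` inside the parabola this is `HasTypeIDecay K' u`.  The symmetry is NOT used
(triage r1-1, S6 remark), which is why this is its own stub. -/
theorem stub_oseenBootstrap :
    ∀ (C : ℝ) (u : ℝ → EuclideanSpace ℝ (Fin 3) → EuclideanSpace ℝ (Fin 3)),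
      IsTypeIAncientMild C u →
      (∀ ε > 0, ∃ R : ℝ, ∀ t < 0, ∀ x, R * Real.sqrt (-t) ≤ ‖x‖ → Real.sqrt (-t) * ‖u t x‖ ≤ ε) →
      ∃ K : ℝ, HasTypeIDecay K u := by
  sorry

/-- **Stub 3 — the self-similar leaf `(D₀)`: a backward self-similar element of `A_C` vanishes** (Tsai 1998
Thm 1, `q = ∞`, in the gauge class; size M, KNOWN).  If `u ∈ A_C` is annihilated by the pure scaling generator
about the space–time origin, `x·∇u + u + 2t ∂_t u = 0`, then `u ≡ 0`.  Proof plan: integrating the generator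
along `λ ↦ λu(λ²t, λx)` gives `u(t,x) = (−t)^{-1/2} U(x/√(−t))` with `U = u(−1,·)` smooth, divergence free and
BOUNDED (`‖U‖ ≤ C`, the Type-I bound at `t = −1`); with the KNSS pressure (tree bridge
`IsTypeIAncientMild.exists_isClassicalNSSolutionOn_Ioo`) `(U, P)` is a Leray profile pair (`IsLerayProfile`), so
Tsai's theorem — tree `tsai_selfsimilar_bounded_holds` — makes `U ≡ c` constant; then every slice
`u(t,·) = c/√(−t)` is spatially constant and the gauge kills it: `IsTypeIAncientMild.eq_zero_of_slice_const`
(KNSS Rem. 6.1; exactly where `Disproof.symmetricLiouville_false_without_mild` bites — the parasitic `c/√(−t)`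
solves the symmetry).  Cf. the route's foreseen `SlabSelfSimilarRigidity`. -/
theorem stub_selfSimilarLeaf :
    ∀ (C : ℝ) (u : ℝ → EuclideanSpace ℝ (Fin 3) → EuclideanSpace ℝ (Fin 3)),
      IsTypeIAncientMild C u →
      (∀ t < 0, ∀ x, fderiv ℝ (u t) x x + u t x + (2 * t) • timeDeriv u t x = 0) →
      ∀ t < 0, ∀ x, u t x = 0 := by
  sorry

/-- **Stub 4 — rotated self-similar Liouville with SPACE–TIME Type-I profile, every rotation rate** (the
card's residual = the disprover's `RotatedSelfSimilarLiouvilleDecaying`, Disproof.lean §(b); X-strength on its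
leaf; HARDEST).  If `u ∈ A_C` also obeys `‖u(t,x)‖ ≤ K/(‖x‖ + √(−t))` and is annihilated by the rotated-scaling
generator `∇u·(x + Ax) + u + 2t ∂_t u − Au = 0` with `A ≠ 0` skew (so `u` is Pineau–Vicol's ansatz (1.7) with a
`C^∞` profile decaying like `1/|y|` and angular speed `α = ‖A‖/2` about the axis `ker A`), then `u ≡ 0`.
Status: PROVED for `|α| < α₁(K)` and `|α| > α₂(K)` — Pineau–Vicol 2026 Thm 1.4 = tree named fact
`pineauVicol2026_rss_liouville` (its hypothesis (1.10) on `[−1,0)` is `HasTypeIDecay`; classical pair from the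
gauge as in stub 3; `pvAnsatz` after rotating `ker A` onto the `e₃`-axis); OPEN on the compact window
`α₁(K) ≤ |α| ≤ α₂(K)` = Pineau–Vicol Conjecture 1.1 = Tsai 2018 Conj. 8.9 (Perelman).  The crux implies this
statement (`Disproof.symmetricLiouville_implies_rss_decaying`), so it cannot be weakened; a nonzero window
profile refutes this stub, the crux, the target `X` and the route (KILL CRITERIA (2)).  Necessary condition for
such a profile on record: chirality `sign(α)·∫Ω₃ w_α > 0` (card `spiral-weight-killing-pairing`). -/
theorem stub_rotatedSelfSimilarDecayingLiouville :
    ∀ (C K : ℝ) (u : ℝ → EuclideanSpace ℝ (Fin 3) → EuclideanSpace ℝ (Fin 3))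
      (A : EuclideanSpace ℝ (Fin 3) →L[ℝ] EuclideanSpace ℝ (Fin 3)),
      IsTypeIAncientMild C u → HasTypeIDecay K u →
      (∀ x, inner ℝ (A x) x = 0) → A ≠ 0 →
      (∀ t < 0, ∀ x, fderiv ℝ (u t) x (x + A x) + u t x + (2 * t) • timeDeriv u t x - A (u t x) = 0) →
      ∀ t < 0, ∀ x, u t x = 0 := by
  sorry

/-! ## Conjugation by translations (sorry-free helpers) -/

/-- **`A_C` is invariant under space translations** `u ↦ u(·, · + c)` (same constant): smoothness and the
divergence condition are translation covariant (`fderiv_comp_add_right`, tree `IsDivFree.comp_add_right`), the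
heat flow and the Oseen–Duhamel term commute with translations (tree `heatFlow_comp_add_right`,
`oseenDuhamel_comp_add_right`), and the Type-I bound is uniform in `x`. (KNSS 2009 §1: the symmetries of the
problem; companion of the tree's time-shift covariance `IsTypeIAncientMild.comp_sub_right`.) -/
theorem isTypeIAncientMild_comp_add_right {C : ℝ}
    {u : ℝ → EuclideanSpace ℝ (Fin 3) → EuclideanSpace ℝ (Fin 3)} (h : IsTypeIAncientMild C u)
    (c : EuclideanSpace ℝ (Fin 3)) : IsTypeIAncientMild C (fun t x => u t (x + c)) := by
  refine ⟨?_, fun t ht => (h.isDivFree ht).comp_add_right c, fun s t hst ht x => ?_,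
    fun t ht x => h.norm_le ht (x + c)⟩
  · have e : (uncurry fun t x => u t (x + c)) =
        uncurry u ∘ fun p : ℝ × EuclideanSpace ℝ (Fin 3) => (p.1, p.2 + c) := by
      funext p
      rfl
    rw [e]
    refine h.contDiffOn.comp ((contDiff_fst.prodMk (contDiff_snd.add contDiff_const)).contDiffOn) ?_
    intro p hp
    exact mem_prod.2 ⟨(mem_prod.1 hp).1, mem_univ _⟩
  · show u t (x + c) = heatFlow (fun y => u s (y + c)) (t - s) x -
        oseenDuhamel 1 s (fun τ y => u τ (y + c)) (fun τ y => u τ (y + c)) t x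
    rw [heatFlow_comp_add_right, oseenDuhamel_comp_add_right]
    exact h.mild_eq hst ht (x + c)

/-- For `σ ≠ 0` and `A` skew, `σ + A` is invertible: the spiral scaling `ξ = (a, σ, A)` has a centre `c`,
`σc + Ac = −a` (`⟪(σ + A)v, v⟫ = σ‖v‖²`, so `σ + A` is injective, hence surjective on `ℝ³`). -/
theorem exists_spiral_centre {σ : ℝ} (hσ : σ ≠ 0)
    {A : EuclideanSpace ℝ (Fin 3) →L[ℝ] EuclideanSpace ℝ (Fin 3)} (hA : ∀ x, inner ℝ (A x) x = 0)
    (a : EuclideanSpace ℝ (Fin 3)) : ∃ c : EuclideanSpace ℝ (Fin 3), σ • c + A c = -a := by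
  let M : EuclideanSpace ℝ (Fin 3) →ₗ[ℝ] EuclideanSpace ℝ (Fin 3) :=
    σ • LinearMap.id + (A : EuclideanSpace ℝ (Fin 3) →ₗ[ℝ] EuclideanSpace ℝ (Fin 3))
  have hM : ∀ v, M v = σ • v + A v := fun v => rfl
  have hinj : Function.Injective M := by
    intro v w hvw
    have h0 : M (v - w) = 0 := by rw [map_sub, hvw, sub_self]
    rw [hM] at h0
    have h1 : inner ℝ (σ • (v - w) + A (v - w)) (v - w) = 0 := by rw [h0, inner_zero_left]
    rw [inner_add_left, hA (v - w), add_zero, real_inner_smul_left, real_inner_self_eq_norm_sq] at h1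
    have h2 : ‖v - w‖ ^ 2 = 0 := by
      rcases mul_eq_zero.1 h1 with h | h
      · exact absurd h hσ
      · exact h
    have h3 : v - w = 0 := by
      rw [← norm_eq_zero]
      exact pow_eq_zero_iff two_ne_zero |>.1 h2
    exact sub_eq_zero.1 h3
  obtain ⟨c, hc⟩ := (LinearMap.injective_iff_surjective.1 hinj) (-a)
  exact ⟨c, by rw [← hM]; exact hc⟩

/-! ## Backward ends versus the whole past (sorry-free; for the provers of stubs H / Ax)

The route items (= stubs H, Ax) are stated on backward ENDS `t < θ`; the card, the sibling lines and the tree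
theorems work on the whole past `t < 0`. For a TIME-INDEPENDENT (Killing) symmetry the two are equivalent: the
backward shift `u(· + θ)` of an element of `A_C` is again in `A_C` (`IsTypeIAncientMild.comp_sub_right`, `−θ ≥ 0`)
and carries the same symmetry on all of `t < 0`. -/

/-- **End-to-past reduction for Killing symmetries.** If every `v ∈ A_C` annihilated on the whole past by the
time-independent generator `b·∇ − A` vanishes, then every `u ∈ A_C` annihilated by it on a backward end `t < θ`
(`θ ≤ 0`) vanishes on that end (apply the hypothesis to `v = u(· + θ) ∈ A_C`). -/
theorem vanishesOnEnd_of_vanishesOnPast {C : ℝ}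
    {u : ℝ → EuclideanSpace ℝ (Fin 3) → EuclideanSpace ℝ (Fin 3)} (hcl : IsTypeIAncientMild C u)
    {θ : ℝ} (hθ : θ ≤ 0)
    (b : EuclideanSpace ℝ (Fin 3) → EuclideanSpace ℝ (Fin 3))
    (A : EuclideanSpace ℝ (Fin 3) →L[ℝ] EuclideanSpace ℝ (Fin 3))
    (hsym : ∀ t < θ, ∀ x, fderiv ℝ (u t) x (b x) - A (u t x) = 0)
    (hpast : ∀ v : ℝ → EuclideanSpace ℝ (Fin 3) → EuclideanSpace ℝ (Fin 3), IsTypeIAncientMild C v →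
      (∀ t < 0, ∀ x, fderiv ℝ (v t) x (b x) - A (v t x) = 0) → ∀ t < 0, ∀ x, v t x = 0) :
    ∀ t < θ, ∀ x, u t x = 0 := by
  intro t ht x
  have hv : IsTypeIAncientMild C (fun s => u (s - -θ)) := hcl.comp_sub_right (by linarith)
  have hsv : ∀ s < 0, ∀ y,
      fderiv ℝ ((fun s => u (s - -θ)) s) y (b y) - A ((fun s => u (s - -θ)) s y) = 0 := by
    intro s hs y
    exact hsym (s - -θ) (by linarith) y
  have key := hpast (fun s => u (s - -θ)) hv hsv (t - θ) (by linarith) x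
  have e : t - θ - -θ = t := by ring
  simpa only [e] using key

/-- Stub H follows from its whole-past case `θ = 0` (so a proof of the sibling cards' `PeriodicTypeIAncientLiouville`
/ `helical_leaf` / `ScrewLeaf`, all stated on `t < 0`, closes stub H in one line). -/
theorem helicalEnd_of_past
    (h0 : ∀ (C : ℝ) (u : ℝ → EuclideanSpace ℝ (Fin 3) → EuclideanSpace ℝ (Fin 3)),
      IsTypeIAncientMild C u →
      ∀ (a : EuclideanSpace ℝ (Fin 3)) (A : EuclideanSpace ℝ (Fin 3) →L[ℝ] EuclideanSpace ℝ (Fin 3)),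
        (∀ x, inner ℝ (A x) x = 0) → a ∉ Set.range A →
        (∀ t < 0, ∀ x, fderiv ℝ (u t) x (a + A x) - A (u t x) = 0) → ∀ t < 0, ∀ x, u t x = 0) :
    ∀ (C : ℝ) (u : ℝ → EuclideanSpace ℝ (Fin 3) → EuclideanSpace ℝ (Fin 3)),
      IsTypeIAncientMild C u →
      ∀ (a : EuclideanSpace ℝ (Fin 3)) (A : EuclideanSpace ℝ (Fin 3) →L[ℝ] EuclideanSpace ℝ (Fin 3)) (θ : ℝ),
        (∀ x, inner ℝ (A x) x = 0) → a ∉ Set.range A → θ ≤ 0 →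
        (∀ t < θ, ∀ x, fderiv ℝ (u t) x (a + A x) - A (u t x) = 0) →
        ∀ t < θ, ∀ x, u t x = 0 := by
  intro C u hcl a A θ hA hra hθ hsym
  exact vanishesOnEnd_of_vanishesOnPast hcl hθ (fun x => a + A x) A hsym
    (fun v hv hsv => h0 C v hv a A hA hra hsv)

/-- Stub Ax follows from its whole-past case `θ = 0` (so a proof of the sibling cards' `AxisymmetricLeafOfCOverR` +
`AxisymmetricAxisRate` / `axisymmetric_leaf`, stated on `t < 0`, closes stub Ax in one line). -/
theorem axisymEnd_of_past
    (h0 : ∀ (C : ℝ) (u : ℝ → EuclideanSpace ℝ (Fin 3) → EuclideanSpace ℝ (Fin 3)),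
      IsTypeIAncientMild C u →
      ∀ (c : EuclideanSpace ℝ (Fin 3)) (A : EuclideanSpace ℝ (Fin 3) →L[ℝ] EuclideanSpace ℝ (Fin 3)),
        (∀ x, inner ℝ (A x) x = 0) → A ≠ 0 →
        (∀ t < 0, ∀ x, fderiv ℝ (u t) x (A (x - c)) - A (u t x) = 0) → ∀ t < 0, ∀ x, u t x = 0) :
    ∀ (C : ℝ) (u : ℝ → EuclideanSpace ℝ (Fin 3) → EuclideanSpace ℝ (Fin 3)),
      IsTypeIAncientMild C u →
      ∀ (c : EuclideanSpace ℝ (Fin 3)) (A : EuclideanSpace ℝ (Fin 3) →L[ℝ] EuclideanSpace ℝ (Fin 3)) (θ : ℝ),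
        (∀ x, inner ℝ (A x) x = 0) → A ≠ 0 → θ ≤ 0 →
        (∀ t < θ, ∀ x, fderiv ℝ (u t) x (A (x - c)) - A (u t x) = 0) →
        ∀ t < θ, ∀ x, u t x = 0 := by
  intro C u hcl c A θ hA hA0 hθ hsym
  exact vanishesOnEnd_of_vanishesOnPast hcl hθ (fun x => A (x - c)) A hsym
    (fun v hv hsv => h0 C v hv c A hA hA0 hsv)

/-! ## The composition (sorry-free) -/

/-- **The skeleton concludes the crux BY NAME**: `SymmetricLiouville` (route `SymmetryModuliCount`,
stmt-NavierStokesRegularity-4053) from the six registered stubs.  Conjugacy bookkeeping done here: `σ = 0` ⇒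
Killing generator `(a, A)`, split on `a ∈ range A` (rotation about the axis through `−c`, `a = Ac`: stub Ax at
`θ = 0`) / `a ∉ range A` (translation or nonzero-pitch screw: stub H at `θ = 0`); `σ ≠ 0` ⇒ translate to the
centre `c` of the spiral scaling (`exists_spiral_centre`, `isTypeIAncientMild_comp_add_right`), divide the
generator by `σ`, and split on `A/σ = 0` (Tsai leaf, stub 3) / `≠ 0` (stubs 1 → 2 → 4). -/
theorem SymmetricLiouville_of : SymmetricLiouville := by
  intro C u hu a σ A hA hne hL t ht x
  have hcl : IsTypeIAncientMild C u := isTypeIAncientMild_iff.2 hu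
  rcases eq_or_ne σ 0 with rfl | hσ
  · -- ISOMETRIC (Killing) leaves: `L_ξ u = ∇u·(a + Ax) − Au`
    have hK : ∀ t < 0, ∀ x, fderiv ℝ (u t) x (a + A x) - A (u t x) = 0 := by
      intro t ht x
      have h1 := hL t ht x
      simp only [zero_smul, add_zero, mul_zero, zero_mul] at h1
      exact h1
    by_cases hra : a ∈ Set.range A
    · -- rotation about the axis through `-c`: stub Ax at `θ = 0`
      obtain ⟨c, hc⟩ := hra
      have hA0 : A ≠ 0 := by
        rintro rfl
        apply hne
        refine ⟨?_, rfl, rfl⟩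
        rw [← hc, zero_apply]
      refine stub_axisymEndLiouville C u hcl (-c) A 0 hA hA0 le_rfl ?_ t ht x
      intro t ht x
      have e : A (x - -c) = a + A x := by
        rw [sub_neg_eq_add, map_add, hc, add_comm]
      rw [e]
      exact hK t ht x
    · -- translation or screw of nonzero pitch: stub H at `θ = 0`
      exact stub_helicalEndLiouville C u hcl a A 0 hA hra le_rfl hK t ht x
  · -- SPIRAL SCALINGS `σ ≠ 0`: translate to the centre, normalise the rate to `1`
    obtain ⟨c, hc⟩ := exists_spiral_centre hσ hA a
    have hv : IsTypeIAncientMild C (fun t x => u t (x + c)) := isTypeIAncientMild_comp_add_right hcl c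
    obtain ⟨A', hA'def⟩ :
        ∃ A' : EuclideanSpace ℝ (Fin 3) →L[ℝ] EuclideanSpace ℝ (Fin 3), A' = σ⁻¹ • A := ⟨_, rfl⟩
    have hA' : ∀ x, inner ℝ (A' x) x = 0 := by
      intro x
      rw [hA'def, smul_apply, real_inner_smul_left, hA x, mul_zero]
    -- the normalised symmetry of the translated field
    have hLv : ∀ t < 0, ∀ x, fderiv ℝ (fun y => u t (y + c)) x (x + A' x) + u t (x + c) +
        (2 * t) • timeDeriv (fun s y => u s (y + c)) t x - A' (u t (x + c)) = 0 := by
      intro t ht x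
      have key := hL t ht (x + c)
      have e1 : a + σ • (x + c) + A (x + c) = σ • x + A x := by
        have h0 : σ • c + A c + a = 0 := by rw [hc, neg_add_cancel]
        calc a + σ • (x + c) + A (x + c) = σ • x + A x + (σ • c + A c + a) := by
              rw [smul_add, map_add]; abel
          _ = σ • x + A x := by rw [h0, add_zero]
      rw [e1] at key
      have e2 : fderiv ℝ (fun y => u t (y + c)) x = fderiv ℝ (u t) (x + c) := by
        rw [fderiv_comp_add_right]
      have e3 : timeDeriv (fun s y => u s (y + c)) t x = timeDeriv u t (x + c) := rfl
      rw [e2, e3]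
      have k2 := congrArg (fun w => σ⁻¹ • w) key
      simp only [smul_zero, smul_add, smul_sub, smul_smul, inv_mul_cancel₀ hσ, one_smul] at k2
      have e5 : σ⁻¹ * (2 * σ * t) = 2 * t := by
        rw [mul_comm 2 σ, mul_assoc, inv_mul_cancel_left₀ hσ]
      have e6 : σ⁻¹ • fderiv ℝ (u t) (x + c) (σ • x + A x) = fderiv ℝ (u t) (x + c) (x + A' x) := by
        rw [← (fderiv ℝ (u t) (x + c)).map_smul]
        congr 1
        rw [hA'def, smul_apply, smul_add, smul_smul, inv_mul_cancel₀ hσ, one_smul]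
      have e7 : σ⁻¹ • A (u t (x + c)) = A' (u t (x + c)) := by
        rw [hA'def, smul_apply]
      rw [e5, e6, e7] at k2
      exact k2
    -- conclude on the translated field, then translate back
    suffices hzero : ∀ t < 0, ∀ x, (fun t x => u t (x + c)) t x = 0 by
      have := hzero t ht (x - c)
      simpa only [sub_add_cancel] using this
    rcases eq_or_ne A' 0 with hA0 | hA0
    · -- pure scaling: Tsai leaf (stub 3)
      refine stub_selfSimilarLeaf C (fun t x => u t (x + c)) hv ?_
      intro t ht x
      have h1 := hLv t ht x
      rw [hA0] at h1
      simp only [zero_apply, add_zero, sub_zero] at h1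
      exact h1
    · -- rotated scaling: far-field vanishing (stub 1) ⇒ space–time Type I (stub 2) ⇒ RSS Liouville (stub 4)
      obtain ⟨K, hK⟩ := stub_oseenBootstrap C (fun t x => u t (x + c)) hv
        (stub_spiralFarFieldVanishing C (fun t x => u t (x + c)) A' hv hA' hLv)
      exact stub_rotatedSelfSimilarDecayingLiouville C K (fun t x => u t (x + c)) A' hv hK hA' hA0 hLv

end Summit.NavierStokesRegularity.NavierStokesRegularity.Cruxes.SymmetricLiouville.DegenerateStabiliserZoom

end
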